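import Mathlib
import HarnessLib
import Literature.MeasureTheory.Integral.WholeAxisSubstitution

/-!
# Conversions to the whole axis (Davis–Rabinowitz 1984, Sect. 3.4.5)

Davis–Rabinowitz, *Methods of Numerical Integration* (2nd ed., 1984), Sect. 3.4 (the rectangular /
trapezoidal rule on `(-∞, ∞)` converges very fast for analytic integrands), Sect. 3.4.5
"Conversions to the Whole Axis": Schwartz suggests converting integrals over finite or
semi-infinite intervals to `(-∞, ∞)` by the transforms

* `x = 1/(1 + e^{-y})`, `0 ≤ x ≤ 1`;
* `x = (e^y - 1)/(e^y + 1)`, `-1 ≤ x ≤ 1`;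
* `x = e^y`, `0 ≤ x < ∞`;

and, for a more rapid decay at `±∞`, the further transformation
`∫_{-∞}^{∞} f(x) dx = ∫_{-∞}^{∞} g(y) dy`, `g(y) = (e^y + e^{-y}) f(e^y - e^{-y})` (3.4.5.1).
Explicitly these lead to the rules (the rectangular rule `h Σ_m g(hm)` applied to the transformed
integrand)

* (3.4.5.2) `∫_{-1}^{1} f(x) dx = h Σ_{m=-∞}^{∞} (2e^{hm}/(1+e^{hm})²) f((e^{hm}-1)/(e^{hm}+1)) + E_h(f)`
  (the "tanh rule"),
* (3.4.5.3) `∫_0^∞ f(x) dx = h Σ_{m=-∞}^{∞} e^{hm} f(e^{hm}) + E_h(f)`,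

and Haber's analysis of the truncated tanh rule `E_{N,h}` (3.4.5.5) in the Hardy space `H_2` with the
near-optimal step `ĥ(N) = π √(2/N) - 1/N` (3.4.5.6).

What is formalised here (Mathlib only):

* the three Schwartz maps and the map of (3.4.5.1) with their derivatives, monotonicity and ranges
  (`schwartzLogistic`, `schwartzTanh`, `Real.exp`, `doubleSinh`);
* **the substitution identities behind the rules, as theorems** (no integrability hypotheses — both
  sides are the Bochner integral): `∫_0^1 f = ∫ e^{-y}/(1+e^{-y})² f(1/(1+e^{-y})) dy`
  (`integral_Ioo_zero_one_eq_logistic`), `∫_{-1}^1 f = ∫ 2e^y/(1+e^y)² f((e^y-1)/(e^y+1)) dy`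
  (`integral_Ioo_eq_schwartzTanh`), `∫_0^∞ f = ∫ e^y f(e^y) dy` (`integral_Ioi_eq_exp`), and
  (3.4.5.1) `∫ f = ∫ (e^y + e^{-y}) f(e^y - e^{-y}) dy` (`integral_eq_doubleSinh`);
* the rules (3.4.5.2), (3.4.5.3) and the truncated error functional (3.4.5.5) as definitions, each
  shown to be the whole-axis rectangular rule applied to the transformed integrand, and Haber's step
  `haberStep`.

Not formalised: Stenger's and Haber's error estimates ((3.4.5.6) is an asymptotic expansion), the
Takahasi–Mori `erf` rules (3.4.5.7)–(3.4.5.9) and the IMT-type rules that follow.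

**Prior art in the tree (cross-referenced by this revision).** The substitutions of Sect. 3.4.5 were already
formalised, in the `tanh u` / `c sinh u` parametrisation and with interval integrals, in
`Literature.MeasureTheory.Integral.WholeAxisSubstitution` (`integral_tanh_substitution`,
`integral_unitInterval_tanh_substitution`, `integral_sinh_substitution`, `integral_exp_substitution`,
`image_tanh_univ`, `image_exp_univ`; the `erf` rules are `Literature.MeasureTheory.Integral.TakahasiMoriSubstitutions`,
the tanh–sinh rule is `Literature.Analysis.Quadrature.TanhSinhTransformation`). Here `integral_Ioi_eq_exp` is a
re-export of `integral_exp_substitution` and `integral_eq_doubleSinh` is derived from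
`integral_sinh_substitution (c := 2)`; `integral_Ioo_eq_schwartzTanh` / `integral_Ioo_zero_one_eq_logistic` are the
`y = 2u` reparametrisations of `integral_tanh_substitution` / `integral_unitInterval_tanh_substitution` written with
the maps printed in DR84 and set integrals. What this file adds is the DR84 maps as named functions with
derivatives, monotonicity and ranges, and the rule functionals (3.4.5.2), (3.4.5.3), (3.4.5.5), (3.4.5.6) reduced to
the whole-axis rectangular rule.
-/

open MeasureTheory Set

namespace Literature.Analysis.Quadrature

/-! ## The maps -/

/-- Schwartz's map for `[0, 1]`: `x = 1/(1 + e^{-y})`. [cite: DavisRabinowitz1984, Sect. 3.4.5] -/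
noncomputable def schwartzLogistic (y : ℝ) : ℝ := 1 / (1 + Real.exp (-y))

/-- Schwartz's map for `[-1, 1]`: `x = (e^y - 1)/(e^y + 1)` (`= tanh (y/2)`).
[cite: DavisRabinowitz1984, Sect. 3.4.5 (3.4.5.2)] -/
noncomputable def schwartzTanh (y : ℝ) : ℝ := (Real.exp y - 1) / (Real.exp y + 1)

/-- The map of (3.4.5.1): `x = e^y - e^{-y}` (`= 2 sinh y`).
[cite: DavisRabinowitz1984, Sect. 3.4.5 (3.4.5.1)] -/
noncomputable def doubleSinh (y : ℝ) : ℝ := Real.exp y - Real.exp (-y)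

/-- `d/dy [1/(1+e^{-y})] = e^{-y}/(1+e^{-y})²`. [cite: DavisRabinowitz1984, Sect. 3.4.5] -/
theorem hasDerivAt_schwartzLogistic (y : ℝ) :
    HasDerivAt schwartzLogistic (Real.exp (-y) / (1 + Real.exp (-y)) ^ 2) y := by
  have hd : HasDerivAt (fun y : ℝ => 1 + Real.exp (-y)) (-Real.exp (-y)) y := by
    have := ((hasDerivAt_neg y).exp).const_add 1
    simpa using this
  have hne : (1 + Real.exp (-y)) ≠ 0 := by positivity
  have h := (hasDerivAt_const y (1 : ℝ)).div hd hne
  exact h.congr_deriv (by ring)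

/-- `d/dy [(e^y-1)/(e^y+1)] = 2e^y/(1+e^y)²`. [cite: DavisRabinowitz1984, Sect. 3.4.5 (3.4.5.2)] -/
theorem hasDerivAt_schwartzTanh (y : ℝ) :
    HasDerivAt schwartzTanh (2 * Real.exp y / (1 + Real.exp y) ^ 2) y := by
  have h1 : HasDerivAt (fun y : ℝ => Real.exp y - 1) (Real.exp y) y := (Real.hasDerivAt_exp y).sub_const 1
  have h2 : HasDerivAt (fun y : ℝ => Real.exp y + 1) (Real.exp y) y := (Real.hasDerivAt_exp y).add_const 1
  have hne : (Real.exp y + 1) ≠ 0 := by positivity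
  have h := h1.div h2 hne
  exact h.congr_deriv (by ring)

/-- `d/dy [e^y - e^{-y}] = e^y + e^{-y}`. [cite: DavisRabinowitz1984, Sect. 3.4.5 (3.4.5.1)] -/
theorem hasDerivAt_doubleSinh (y : ℝ) :
    HasDerivAt doubleSinh (Real.exp y + Real.exp (-y)) y := by
  have h := (Real.hasDerivAt_exp y).sub (hasDerivAt_neg y).exp
  exact h.congr_deriv (by ring)

/-- `x = 1/(1+e^{-y})` is strictly increasing. [cite: DavisRabinowitz1984, Sect. 3.4.5] -/
theorem strictMono_schwartzLogistic : StrictMono schwartzLogistic := by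
  intro a b hab
  unfold schwartzLogistic
  have hb : 0 < 1 + Real.exp (-b) := by positivity
  have : Real.exp (-b) < Real.exp (-a) := Real.exp_lt_exp.mpr (by linarith)
  exact one_div_lt_one_div_of_lt hb (by linarith)

/-- `x = (e^y-1)/(e^y+1)` is strictly increasing. [cite: DavisRabinowitz1984, Sect. 3.4.5 (3.4.5.2)] -/
theorem strictMono_schwartzTanh : StrictMono schwartzTanh := by
  intro a b hab
  unfold schwartzTanh
  have ha : 0 < Real.exp a + 1 := by positivity
  have hab' : Real.exp a < Real.exp b := Real.exp_lt_exp.mpr hab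
  have e : ∀ t : ℝ, (Real.exp t - 1) / (Real.exp t + 1) = 1 - 2 * (1 / (Real.exp t + 1)) := by
    intro t
    have : Real.exp t + 1 ≠ 0 := by positivity
    field_simp
    ring
  rw [e, e]
  have h := one_div_lt_one_div_of_lt ha (by linarith : Real.exp a + 1 < Real.exp b + 1)
  linarith

/-- `x = e^y - e^{-y}` is strictly increasing. [cite: DavisRabinowitz1984, Sect. 3.4.5 (3.4.5.1)] -/
theorem strictMono_doubleSinh : StrictMono doubleSinh := by
  intro a b hab
  unfold doubleSinh
  have h1 : Real.exp a < Real.exp b := Real.exp_lt_exp.mpr hab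
  have h2 : Real.exp (-b) < Real.exp (-a) := Real.exp_lt_exp.mpr (by linarith)
  linarith

/-- The range of `x = 1/(1+e^{-y})` is `(0, 1)` (inverse `y = log (x/(1-x))`).
[cite: DavisRabinowitz1984, Sect. 3.4.5] -/
theorem range_schwartzLogistic : range schwartzLogistic = Ioo 0 1 := by
  ext x
  constructor
  · rintro ⟨y, rfl⟩
    unfold schwartzLogistic
    have h : 0 < 1 + Real.exp (-y) := by positivity
    refine ⟨by positivity, ?_⟩
    rw [div_lt_one h]
    linarith [Real.exp_pos (-y)]
  · rintro ⟨h0, h1⟩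
    refine ⟨Real.log (x / (1 - x)), ?_⟩
    unfold schwartzLogistic
    have h1' : 0 < 1 - x := by linarith
    rw [Real.exp_neg, Real.exp_log (div_pos h0 h1')]
    field_simp
    ring

/-- The range of `x = (e^y-1)/(e^y+1)` is `(-1, 1)` (inverse `y = log ((1+x)/(1-x))`; cf. the tree's
`Literature.MeasureTheory.Integral.image_tanh_univ` for `tanh`). [cite: DavisRabinowitz1984, Sect. 3.4.5 (3.4.5.2)] -/
theorem range_schwartzTanh : range schwartzTanh = Ioo (-1) 1 := by
  ext x
  constructor
  · rintro ⟨y, rfl⟩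
    unfold schwartzTanh
    have h : 0 < Real.exp y + 1 := by positivity
    refine ⟨?_, ?_⟩
    · rw [lt_div_iff₀ h]; linarith [Real.exp_pos y]
    · rw [div_lt_one h]; linarith
  · rintro ⟨h0, h1⟩
    refine ⟨Real.log ((1 + x) / (1 - x)), ?_⟩
    unfold schwartzTanh
    have h1' : 0 < 1 - x := by linarith
    have h0' : 0 < 1 + x := by linarith
    rw [Real.exp_log (div_pos h0' h1')]
    field_simp
    ring

/-- The range of `x = e^y - e^{-y} = 2 sinh y` is all of `ℝ`.
[cite: DavisRabinowitz1984, Sect. 3.4.5 (3.4.5.1)] -/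
theorem range_doubleSinh : range doubleSinh = univ := by
  refine eq_univ_of_forall (fun x => ?_)
  obtain ⟨y, hy⟩ := Real.sinh_surjective (x / 2)
  refine ⟨y, ?_⟩
  unfold doubleSinh
  rw [Real.sinh_eq] at hy
  linarith

/-! ## The substitution identities -/

/-- **`∫_0^1 f(x) dx = ∫_{-∞}^{∞} e^{-y}/(1+e^{-y})² f(1/(1+e^{-y})) dy`** (substitution
`x = 1/(1+e^{-y})`; the `y = 2u` reparametrisation, with a set integral, of the tree's
`Literature.MeasureTheory.Integral.integral_unitInterval_tanh_substitution`, `x = (1 + tanh u)/2`).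
[cite: DavisRabinowitz1984, Sect. 3.4.5] -/
theorem integral_Ioo_zero_one_eq_logistic (f : ℝ → ℝ) :
    ∫ x in Ioo (0 : ℝ) 1, f x
      = ∫ y : ℝ, Real.exp (-y) / (1 + Real.exp (-y)) ^ 2 * f (schwartzLogistic y) := by
  have himg : schwartzLogistic '' univ = Ioo 0 1 := by rw [image_univ, range_schwartzLogistic]
  have h := integral_image_eq_integral_abs_deriv_smul (s := univ) MeasurableSet.univ
    (fun y _ => (hasDerivAt_schwartzLogistic y).hasDerivWithinAt)
    strictMono_schwartzLogistic.injective.injOn f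
  rw [himg, Measure.restrict_univ] at h
  rw [h]
  refine integral_congr_ae (Filter.Eventually.of_forall fun y => ?_)
  simp only [smul_eq_mul]
  rw [abs_of_pos (by positivity)]

/-- **`∫_{-1}^{1} f(x) dx = ∫_{-∞}^{∞} 2e^y/(1+e^y)² f((e^y-1)/(e^y+1)) dy`**, the substitution behind
the tanh rule (3.4.5.2) (the `y = 2u` reparametrisation, with a set integral, of the tree's
`Literature.MeasureTheory.Integral.integral_tanh_substitution`: `∫ x in -1..1, f x = ∫ u, f (tanh u) / cosh² u`).
[cite: DavisRabinowitz1984, Sect. 3.4.5 (3.4.5.2)] -/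
theorem integral_Ioo_eq_schwartzTanh (f : ℝ → ℝ) :
    ∫ x in Ioo (-1 : ℝ) 1, f x
      = ∫ y : ℝ, 2 * Real.exp y / (1 + Real.exp y) ^ 2 * f (schwartzTanh y) := by
  have himg : schwartzTanh '' univ = Ioo (-1) 1 := by rw [image_univ, range_schwartzTanh]
  have h := integral_image_eq_integral_abs_deriv_smul (s := univ) MeasurableSet.univ
    (fun y _ => (hasDerivAt_schwartzTanh y).hasDerivWithinAt)
    strictMono_schwartzTanh.injective.injOn f
  rw [himg, Measure.restrict_univ] at h
  rw [h]
  refine integral_congr_ae (Filter.Eventually.of_forall fun y => ?_)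
  simp only [smul_eq_mul]
  rw [abs_of_pos (by positivity)]

/-- **`∫_0^∞ f(x) dx = ∫_{-∞}^{∞} e^y f(e^y) dy`**, the substitution behind (3.4.5.3) — a re-export, under
the rule API's name, of the tree's `Literature.MeasureTheory.Integral.integral_exp_substitution` (same statement).
[cite: DavisRabinowitz1984, Sect. 3.4.5 (3.4.5.3)] -/
theorem integral_Ioi_eq_exp (f : ℝ → ℝ) :
    ∫ x in Ioi (0 : ℝ), f x = ∫ y : ℝ, Real.exp y * f (Real.exp y) :=
  Literature.MeasureTheory.Integral.integral_exp_substitution f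

/-- **(3.4.5.1)** `∫_{-∞}^{∞} f(x) dx = ∫_{-∞}^{∞} (e^y + e^{-y}) f(e^y - e^{-y}) dy`, derived from the tree's
`Literature.MeasureTheory.Integral.integral_sinh_substitution` with `c = 2` (`2 cosh y = e^y + e^{-y}`,
`2 sinh y = e^y - e^{-y}`). [cite: DavisRabinowitz1984, Sect. 3.4.5 (3.4.5.1)] -/
theorem integral_eq_doubleSinh (f : ℝ → ℝ) :
    ∫ x : ℝ, f x = ∫ y : ℝ, (Real.exp y + Real.exp (-y)) * f (doubleSinh y) := by
  rw [Literature.MeasureTheory.Integral.integral_sinh_substitution (c := 2) two_pos f]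
  refine integral_congr_ae (Filter.Eventually.of_forall fun y => ?_)
  have h1 : 2 * Real.cosh y = Real.exp y + Real.exp (-y) := by rw [Real.cosh_eq]; ring
  have h2 : 2 * Real.sinh y = doubleSinh y := by rw [Real.sinh_eq, doubleSinh]; ring
  simp only [h1, h2]

/-! ## The rules -/

/-- The whole-axis rectangular rule `h Σ_{m ∈ ℤ} g(hm)` of Sect. 3.4.
[cite: DavisRabinowitz1984, Sect. 3.4.5] -/
noncomputable def wholeAxisRule (g : ℝ → ℝ) (h : ℝ) : ℝ := h * ∑' m : ℤ, g (h * m)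

/-- The tanh rule (3.4.5.2): `h Σ_m (2e^{hm}/(1+e^{hm})²) f((e^{hm}-1)/(e^{hm}+1))`.
[cite: DavisRabinowitz1984, Sect. 3.4.5 (3.4.5.2)] -/
noncomputable def tanhRule (f : ℝ → ℝ) (h : ℝ) : ℝ :=
  h * ∑' m : ℤ, 2 * Real.exp (h * m) / (1 + Real.exp (h * m)) ^ 2 * f (schwartzTanh (h * m))

/-- The rule (3.4.5.3): `h Σ_m e^{hm} f(e^{hm})`. [cite: DavisRabinowitz1984, Sect. 3.4.5 (3.4.5.3)] -/
noncomputable def expRule (f : ℝ → ℝ) (h : ℝ) : ℝ :=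
  h * ∑' m : ℤ, Real.exp (h * m) * f (Real.exp (h * m))

/-- The error `E_h(f)` of the tanh rule (3.4.5.2). [cite: DavisRabinowitz1984, Sect. 3.4.5 (3.4.5.2)] -/
noncomputable def tanhRuleError (f : ℝ → ℝ) (h : ℝ) : ℝ := (∫ x in Ioo (-1 : ℝ) 1, f x) - tanhRule f h

/-- The error `E_h(f)` of the rule (3.4.5.3). [cite: DavisRabinowitz1984, Sect. 3.4.5 (3.4.5.3)] -/
noncomputable def expRuleError (f : ℝ → ℝ) (h : ℝ) : ℝ := (∫ x in Ioi (0 : ℝ), f x) - expRule f h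

/-- The truncated tanh rule `h Σ_{m=-N}^{N} …` of (3.4.5.5). [cite: DavisRabinowitz1984, Sect. 3.4.5 (3.4.5.5)] -/
noncomputable def tanhRuleTrunc (f : ℝ → ℝ) (h : ℝ) (N : ℕ) : ℝ :=
  h * ∑ m ∈ Finset.Icc (-(N : ℤ)) N,
    2 * Real.exp (h * m) / (1 + Real.exp (h * m)) ^ 2 * f (schwartzTanh (h * m))

/-- Haber's error functional `E_{N,h} f = ∫_{-1}^1 f - h Σ_{|m| ≤ N} …` (3.4.5.5).
[cite: DavisRabinowitz1984, Sect. 3.4.5 (3.4.5.5)] -/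
noncomputable def haberError (f : ℝ → ℝ) (h : ℝ) (N : ℕ) : ℝ :=
  (∫ x in Ioo (-1 : ℝ) 1, f x) - tanhRuleTrunc f h N

/-- Haber's near-optimal step `ĥ(N) = π √(2/N) - 1/N` (3.4.5.6).
[cite: DavisRabinowitz1984, Sect. 3.4.5 (3.4.5.6)] -/
noncomputable def haberStep (N : ℕ) : ℝ := Real.pi * Real.sqrt (2 / N) - 1 / N

/-- The tanh rule is the whole-axis rectangular rule applied to the transformed integrand of
`integral_Ioo_eq_schwartzTanh`. [cite: DavisRabinowitz1984, Sect. 3.4.5 (3.4.5.2)] -/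
theorem tanhRule_eq_wholeAxisRule (f : ℝ → ℝ) (h : ℝ) :
    tanhRule f h
      = wholeAxisRule (fun y => 2 * Real.exp y / (1 + Real.exp y) ^ 2 * f (schwartzTanh y)) h := rfl

/-- The rule (3.4.5.3) is the whole-axis rectangular rule applied to the transformed integrand of
`integral_Ioi_eq_exp`. [cite: DavisRabinowitz1984, Sect. 3.4.5 (3.4.5.3)] -/
theorem expRule_eq_wholeAxisRule (f : ℝ → ℝ) (h : ℝ) :
    expRule f h = wholeAxisRule (fun y => Real.exp y * f (Real.exp y)) h := rfl

/-- Consequently `E_h(f)` of (3.4.5.3) is the whole-axis rectangular-rule error of `y ↦ e^y f(e^y)`.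
[cite: DavisRabinowitz1984, Sect. 3.4.5 (3.4.5.3)] -/
theorem expRuleError_eq (f : ℝ → ℝ) (h : ℝ) :
    expRuleError f h
      = (∫ y : ℝ, Real.exp y * f (Real.exp y)) - wholeAxisRule (fun y => Real.exp y * f (Real.exp y)) h := by
  rw [expRuleError, integral_Ioi_eq_exp, expRule_eq_wholeAxisRule]

/-- … and `E_h(f)` of the tanh rule is the whole-axis rectangular-rule error of the transformed
integrand. [cite: DavisRabinowitz1984, Sect. 3.4.5 (3.4.5.2)] -/
theorem tanhRuleError_eq (f : ℝ → ℝ) (h : ℝ) :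
    tanhRuleError f h
      = (∫ y : ℝ, 2 * Real.exp y / (1 + Real.exp y) ^ 2 * f (schwartzTanh y))
          - wholeAxisRule (fun y => 2 * Real.exp y / (1 + Real.exp y) ^ 2 * f (schwartzTanh y)) h := by
  rw [tanhRuleError, integral_Ioo_eq_schwartzTanh, tanhRule_eq_wholeAxisRule]

/-- With `N = 0` the truncated tanh rule is the one-point rule `(h/2) f(0)` (weight `2e^0/(1+e^0)^2 = 1/2`,
node `(e^0-1)/(e^0+1) = 0`). [cite: DavisRabinowitz1984, Sect. 3.4.5 (3.4.5.5)] -/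
theorem tanhRuleTrunc_zero (f : ℝ → ℝ) (h : ℝ) : tanhRuleTrunc f h 0 = h / 2 * f 0 := by
  unfold tanhRuleTrunc schwartzTanh
  simp
  ring

end Literature.Analysis.Quadrature
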